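import Mathlib
import HarnessLib
import Literature.Analysis.FluidPDE.PressureRepresentation
import Literature.Analysis.FluidPDE.PineauVicolPressureDecayClass
import Literature.Analysis.FluidPDE.PineauVicolPressureDuality

/-!
# Route `LocalPressureProfileDoor` (door S17⁺), crux K1 `LocalPointZoomSimilarityPressure`
# (stmt-NavierStokesRegularity-20181) — helper 2: the slice lemma for the Riesz pressure potential

Seat `ns-pressure-K1-p1` (`--supports stmt-NavierStokesRegularity-20181`).  The abstract convergence statement behind
the slice-wise convergence of `Q[v] = pressurePotential v = −Q₁^{R,2R}[v] − Q₂^{R,2R}[v]` along a sequence of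
finite-energy slices `V j → W` converging to a decay-class slice:

* `tendsto_nearPotential_of_source` — the NEAR part `Q₁[v](y) = ∫ Γ₀(z) G[v](y − z) dz` converges as soon as the
  sources `G[V j](y − z)` converge pointwise on the kernel ball and are uniformly bounded there (dominated convergence,
  `Γ₀ ∈ L¹`);
* `tendsto_farPotential_of_localDecay` — the FAR part `Q₂[v](y) = ∫ D²Γ∞(y − η)(v η, v η) dη` converges as soon as
  `V j → W` pointwise, the `V j` obey the decay-class bound `A/(1+|η|)` on balls `|η| < ρⱼ`, `ρⱼ → ∞`, and carry energies
  `∫|V j|² ≤ Eⱼ` with `Eⱼ ρⱼ⁻³ → 0` (dominated convergence on the balls with the Peetre dominator `(1+|η|)⁻⁵`, kernel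
  decay `|D²Γ∞(w)| ≲ (1+|w|)⁻³` on the complements);
* `tendsto_pressurePotential_of_near_far` — the two parts give `Q[V j](y) → Q[W](y)` (cutoff independence on the
  finite-energy class for `V j` and on the decay class for `W`).

WHAT THIS IS NOT: not a claim about Navier–Stokes regularity; kernel bookkeeping for a CONDITIONAL door's K1.
-/

noncomputable section

-- the summit and its single sub-problem share the name (CONVENTIONS §1), as in every Theorems file
set_option linter.dupNamespace false
-- nested operator types `ℝ³ →L[ℝ] ℝ³ →L[ℝ] ℝ³ →L[ℝ] ℝ`
set_option maxSynthPendingDepth 3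

namespace Summit.NavierStokesRegularity.NavierStokesRegularity.Theorems.LocalPressureProfileDoorPressureSliceLimit

open MeasureTheory Set Function Filter Topology Metric
open Literature.Analysis Literature.Analysis.FluidPDE
open Literature.Analysis.FluidPDE.FourierNS (HasDecay)
open Literature.Analysis.FluidPDE.PineauVicol2026 (integrable_inv_one_add_norm_pow_five decay_mul_decay_le
  exists_hasDecay_fderiv_newtonFar pressurePotential_eq_scale_decay)

/-! ### The near part -/

/-- **The near potential along a sequence of slices**: if the sources `G[V j](y − z)` converge to `G[W](y − z)` for
`|z| < r₁` and are bounded by `B` there, eventually in `j`, then `Q₁^{r₀,r₁}[V j](y) → Q₁^{r₀,r₁}[W](y)` (dominated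
convergence against the `L¹` kernel `Γ₀^{r₀,r₁}`, which vanishes off the ball `|z| < r₁`). -/
theorem tendsto_nearPotential_of_source {r₀ r₁ : ℝ} (h₀ : 0 ≤ r₀) (h₁ : r₀ < r₁)
    {V : ℕ → EuclideanSpace ℝ (Fin 3) → EuclideanSpace ℝ (Fin 3)}
    {W : EuclideanSpace ℝ (Fin 3) → EuclideanSpace ℝ (Fin 3)} (y : EuclideanSpace ℝ (Fin 3))
    (hV2 : ∀ᶠ j in atTop, ContDiff ℝ 2 (V j))
    (hpt : ∀ z : EuclideanSpace ℝ (Fin 3), ‖z‖ < r₁ →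
      Tendsto (fun j => pressureSource (V j) (y - z)) atTop (𝓝 (pressureSource W (y - z))))
    {B : ℝ} (hB : ∀ᶠ j in atTop, ∀ z : EuclideanSpace ℝ (Fin 3), ‖z‖ < r₁ → |pressureSource (V j) (y - z)| ≤ B) :
    Tendsto (fun j => nearPotential r₀ r₁ (V j) y) atTop (𝓝 (nearPotential r₀ r₁ W y)) := by
  unfold nearPotential
  refine tendsto_integral_filter_of_dominated_convergence (bound := fun z => |newtonNear r₀ r₁ z| * B) ?_ ?_
    ((integrable_newtonNear h₀ h₁).abs.mul_const B) ?_
  · filter_upwards [hV2] with j hj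
    exact ((measurable_newtonNear r₀ r₁).aestronglyMeasurable).mul
      (((contDiff_pressureSource (n := 0) (by exact_mod_cast hj)).continuous.comp
        (continuous_const.sub continuous_id)).aestronglyMeasurable)
  · filter_upwards [hB] with j hj
    refine Eventually.of_forall fun z => ?_
    rw [norm_mul, Real.norm_eq_abs, Real.norm_eq_abs]
    by_cases hz : ‖z‖ < r₁
    · exact mul_le_mul_of_nonneg_left (hj z hz) (abs_nonneg _)
    · rw [newtonNear_eq_zero h₀ h₁ (not_lt.1 hz), abs_zero, zero_mul, zero_mul]
  · refine Eventually.of_forall fun z => ?_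
    by_cases hz : ‖z‖ < r₁
    · exact (hpt z hz).const_mul _
    · simp only [newtonNear_eq_zero h₀ h₁ (not_lt.1 hz), zero_mul]
      exact tendsto_const_nhds

/-! ### The far part -/

/-- The pointwise limit of fields obeying the decay-class bound on exhausting balls obeys it everywhere. -/
theorem decay_of_tendsto_of_localDecay {V : ℕ → EuclideanSpace ℝ (Fin 3) → EuclideanSpace ℝ (Fin 3)}
    {W : EuclideanSpace ℝ (Fin 3) → EuclideanSpace ℝ (Fin 3)}
    (hpt : ∀ η, Tendsto (fun j => V j η) atTop (𝓝 (W η)))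
    {A : ℝ} {ρ : ℕ → ℝ} (hρ : Tendsto ρ atTop atTop)
    (hdecay : ∀ᶠ j in atTop, ∀ η : EuclideanSpace ℝ (Fin 3), ‖η‖ < ρ j → ‖V j η‖ ≤ A / (1 + ‖η‖))
    (η : EuclideanSpace ℝ (Fin 3)) : ‖W η‖ ≤ A / (1 + ‖η‖) := by
  refine le_of_tendsto (hpt η).norm ?_
  filter_upwards [hdecay, hρ.eventually_gt_atTop ‖η‖] with j hj hjρ
  exact hj η hjρ

/-- **The far potential along a sequence of slices**: `V j → W` pointwise, each `V j` continuous with the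
decay-class bound `A/(1+|η|)` on the ball `|η| < ρⱼ` (`ρⱼ → ∞`) and finite energy `∫|V j|² ≤ Eⱼ` with `Eⱼ ρⱼ⁻³ → 0`;
then `Q₂^{r₀,r₁}[V j](y) → Q₂^{r₀,r₁}[W](y)` (no regularity of `W` needed).  Inside the balls: dominated convergence (kernel decay `(1+|w|)⁻³`,
weight `(1+|η|)⁻²`, Peetre dominator `(1+|η|)⁻⁵`); outside: `|y − η| ≥ ρⱼ/2`, so the kernel is `≤ 8M₀ρⱼ⁻³` against
the energy. -/
theorem tendsto_farPotential_of_localDecay {r₀ r₁ : ℝ} (h₀ : 0 < r₀) (h₁ : r₀ < r₁)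
    {V : ℕ → EuclideanSpace ℝ (Fin 3) → EuclideanSpace ℝ (Fin 3)}
    {W : EuclideanSpace ℝ (Fin 3) → EuclideanSpace ℝ (Fin 3)} (y : EuclideanSpace ℝ (Fin 3))
    (hVc : ∀ᶠ j in atTop, Continuous (V j))
    (hpt : ∀ η, Tendsto (fun j => V j η) atTop (𝓝 (W η)))
    {A : ℝ} {ρ : ℕ → ℝ} (hρ : Tendsto ρ atTop atTop)
    (hdecay : ∀ᶠ j in atTop, ∀ η : EuclideanSpace ℝ (Fin 3), ‖η‖ < ρ j → ‖V j η‖ ≤ A / (1 + ‖η‖))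
    {E : ℕ → ℝ} (hL2 : ∀ᶠ j in atTop, Integrable (fun η => ‖V j η‖ ^ 2) ∧ ∫ η, ‖V j η‖ ^ 2 ≤ E j)
    (hE : Tendsto (fun j => E j / ρ j ^ 3) atTop (𝓝 0)) :
    Tendsto (fun j => farPotential r₀ r₁ (V j) y) atTop (𝓝 (farPotential r₀ r₁ W y)) := by
  obtain ⟨⟨M₀, hM₀⟩, -, -⟩ := exists_hasDecay_fderiv_newtonFar h₀ h₁
  have hM₀0 : 0 ≤ M₀ := hM₀.nonneg
  set Φ := fderiv ℝ (fderiv ℝ (newtonFar r₀ r₁)) with hΦ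
  have hΦc : Continuous Φ := (contDiff_fderiv2_newtonFar h₀ h₁).continuous
  have hΦd : ∀ w, ‖Φ w‖ ≤ M₀ / (1 + ‖w‖) ^ 3 := fun w => hM₀ w
  -- the limit is in the decay class, hence `A ≥ 0`
  have hWd : ∀ η, ‖W η‖ ≤ A / (1 + ‖η‖) := decay_of_tendsto_of_localDecay hpt hρ hdecay
  have hA : 0 ≤ A := by
    have := (norm_nonneg _).trans (hWd 0); simpa using this
  -- the integrands
  set F : ℕ → EuclideanSpace ℝ (Fin 3) → ℝ := fun j η => Φ (y - η) (V j η) (V j η) with hF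
  set f : EuclideanSpace ℝ (Fin 3) → ℝ := fun η => Φ (y - η) (W η) (W η) with hf
  set S : ℕ → Set (EuclideanSpace ℝ (Fin 3)) := fun j => {η | ‖η‖ < ρ j} with hS
  have hSm : ∀ j, MeasurableSet (S j) := fun j =>
    (isOpen_lt continuous_norm continuous_const).measurableSet
  have hFc : ∀ᶠ j in atTop, Continuous (F j) := by
    filter_upwards [hVc] with j hj
    exact ((hΦc.comp (continuous_const.sub continuous_id)).clm_apply hj).clm_apply hj
  have hFi : ∀ᶠ j in atTop, Integrable (F j) := by
    filter_upwards [hVc, hL2] with j hj hj2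
    exact integrable_farPotential_integrand h₀ h₁ hj hj2.1 y
  -- pointwise size of the integrand
  have hFle : ∀ j η, ‖F j η‖ ≤ ‖Φ (y - η)‖ * ‖V j η‖ ^ 2 := fun j η => by
    calc ‖F j η‖ = ‖Φ (y - η) (V j η) (V j η)‖ := rfl
      _ ≤ ‖Φ (y - η) (V j η)‖ * ‖V j η‖ := ContinuousLinearMap.le_opNorm _ _
      _ ≤ ‖Φ (y - η)‖ * ‖V j η‖ * ‖V j η‖ := by gcongr; exact ContinuousLinearMap.le_opNorm _ _
      _ = ‖Φ (y - η)‖ * ‖V j η‖ ^ 2 := by ring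
  -- ## (i) inside the balls: dominated convergence
  have hin : Tendsto (fun j => ∫ η, (S j).indicator (F j) η) atTop (𝓝 (∫ η, f η)) := by
    refine tendsto_integral_filter_of_dominated_convergence
      (bound := fun η => M₀ * A ^ 2 * (2 + ‖y‖) ^ 3 * ((1 + ‖η‖) ^ 5)⁻¹) ?_ ?_
      (integrable_inv_one_add_norm_pow_five.const_mul _) ?_
    · filter_upwards [hFc] with j hj
      exact hj.aestronglyMeasurable.indicator (hSm j)
    · filter_upwards [hdecay] with j hj
      refine Eventually.of_forall fun η => ?_
      rw [norm_indicator_eq_indicator_norm]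
      by_cases hη : η ∈ S j
      · rw [indicator_of_mem hη]
        have hVη : ‖V j η‖ ≤ A / (1 + ‖η‖) := hj η hη
        calc ‖F j η‖ ≤ ‖Φ (y - η)‖ * ‖V j η‖ ^ 2 := hFle j η
          _ ≤ M₀ / (1 + ‖y - η‖) ^ 3 * (A / (1 + ‖η‖)) ^ 2 := by
              gcongr
              exact hΦd _
          _ = M₀ / (1 + ‖y - η‖) ^ 3 * (A ^ 2 / (1 + ‖η‖) ^ 2) := by rw [div_pow]
          _ ≤ M₀ * A ^ 2 * (2 + ‖y‖) ^ 3 * ((1 + ‖η‖) ^ 5)⁻¹ :=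
              decay_mul_decay_le hM₀0 (sq_nonneg A) (by simp) η
      · rw [indicator_of_notMem hη]
        positivity
    · refine Eventually.of_forall fun η => ?_
      have hev : ∀ᶠ j in atTop, (S j).indicator (F j) η = F j η := by
        filter_upwards [hρ.eventually_gt_atTop ‖η‖] with j hj
        exact indicator_of_mem (show η ∈ S j from hj) _
      refine Tendsto.congr' (EventuallyEq.symm hev) ?_
      exact ((Φ (y - η)).continuous₂.tendsto (W η, W η)).comp ((hpt η).prodMk_nhds (hpt η))
  -- ## (ii) outside the balls: the kernel is `≤ 8 M₀ / ρⱼ³` against the energy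
  have hout : Tendsto (fun j => ∫ η in (S j)ᶜ, F j η) atTop (𝓝 0) := by
    rw [tendsto_zero_iff_norm_tendsto_zero]
    have hmaj : Tendsto (fun j => 8 * M₀ * (E j / ρ j ^ 3)) atTop (𝓝 0) := by
      simpa using hE.const_mul (8 * M₀)
    refine squeeze_zero' (Eventually.of_forall fun j => norm_nonneg _) ?_ hmaj
    filter_upwards [hFi, hL2, hρ.eventually_ge_atTop (2 * ‖y‖), hρ.eventually_gt_atTop 0] with j hj hj2 hjy hj0
    -- kernel bound on the complement
    have hker : ∀ η ∈ (S j)ᶜ, ‖Φ (y - η)‖ ≤ 8 * M₀ / ρ j ^ 3 := by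
      intro η hη
      have hη' : ρ j ≤ ‖η‖ := not_lt.1 hη
      have hdist : ρ j / 2 ≤ ‖y - η‖ := by
        have := norm_sub_norm_le η y
        rw [norm_sub_rev] at this
        linarith
      calc ‖Φ (y - η)‖ ≤ M₀ / (1 + ‖y - η‖) ^ 3 := hΦd _
        _ ≤ M₀ / (ρ j / 2) ^ 3 := by
            gcongr
            linarith
        _ = 8 * M₀ / ρ j ^ 3 := by field_simp; ring
    calc ‖∫ η in (S j)ᶜ, F j η‖ ≤ ∫ η in (S j)ᶜ, ‖F j η‖ := norm_integral_le_integral_norm _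
      _ ≤ ∫ η in (S j)ᶜ, 8 * M₀ / ρ j ^ 3 * ‖V j η‖ ^ 2 := by
          refine setIntegral_mono_on hj.norm.integrableOn ((hj2.1.const_mul _).integrableOn) (hSm j).compl
            fun η hη => ?_
          exact (hFle j η).trans (mul_le_mul_of_nonneg_right (hker η hη) (sq_nonneg _))
      _ ≤ ∫ η, 8 * M₀ / ρ j ^ 3 * ‖V j η‖ ^ 2 :=
          setIntegral_le_integral (hj2.1.const_mul _) (Eventually.of_forall fun η => by positivity)
      _ = 8 * M₀ / ρ j ^ 3 * ∫ η, ‖V j η‖ ^ 2 := integral_const_mul _ _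
      _ ≤ 8 * M₀ / ρ j ^ 3 * E j := mul_le_mul_of_nonneg_left hj2.2 (by positivity)
      _ = 8 * M₀ * (E j / ρ j ^ 3) := by ring
  -- ## assemble
  have hsplit : ∀ᶠ j in atTop, farPotential r₀ r₁ (V j) y =
      (∫ η, (S j).indicator (F j) η) + ∫ η in (S j)ᶜ, F j η := by
    filter_upwards [hFi] with j hj
    rw [integral_indicator (hSm j), integral_add_compl (hSm j) hj]
    rfl
  have key := hin.add hout
  rw [add_zero] at key
  exact (key.congr' (EventuallyEq.symm hsplit) : _)

/-! ### The pressure potential -/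

/-- **Slice-wise convergence of the Riesz pressure potential from its two parts at cutoff scale `R`**: for finite-energy
`C²` slices `V j` and a decay-class `C²` limit `W`, `Q[·] = −Q₁^{R,2R}[·] − Q₂^{R,2R}[·]` on both sides
(`pressurePotential_eq_scale`, `pressurePotential_eq_scale_decay`), so the convergence of the near and far parts at
scale `R` gives `Q[V j](y) → Q[W](y)`. -/
theorem tendsto_pressurePotential_of_near_far {R : ℝ} (hR : 0 < R)
    {V : ℕ → EuclideanSpace ℝ (Fin 3) → EuclideanSpace ℝ (Fin 3)}
    {W : EuclideanSpace ℝ (Fin 3) → EuclideanSpace ℝ (Fin 3)} (y : EuclideanSpace ℝ (Fin 3))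
    (hV2 : ∀ᶠ j in atTop, ContDiff ℝ 2 (V j)) (hVL2 : ∀ᶠ j in atTop, Integrable fun η => ‖V j η‖ ^ 2)
    (hW2 : ContDiff ℝ 2 W) {Cd : ℝ} (hWd : ∀ η, ‖W η‖ ≤ Cd / (1 + ‖η‖))
    (hnear : Tendsto (fun j => nearPotential (R * 1) (R * 2) (V j) y) atTop
      (𝓝 (nearPotential (R * 1) (R * 2) W y)))
    (hfar : Tendsto (fun j => farPotential (R * 1) (R * 2) (V j) y) atTop
      (𝓝 (farPotential (R * 1) (R * 2) W y))) :
    Tendsto (fun j => pressurePotential (V j) y) atTop (𝓝 (pressurePotential W y)) := by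
  rw [pressurePotential_eq_scale_decay hR hW2 hWd y]
  refine (hnear.neg.sub hfar).congr' ?_
  filter_upwards [hV2, hVL2] with j hj hj2
  rw [pressurePotential_eq_scale hR hj hj2 y]

end Summit.NavierStokesRegularity.NavierStokesRegularity.Theorems.LocalPressureProfileDoorPressureSliceLimit

end
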